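import Summits.BirchSwinnertonDyer.Rank1Residual.F1Sign2.SymSquareAnatomyAtTwo
import HarnessLib

/-!
# ES-34 kernel v2 (typer -ty g22): -es g25's unit lemmas for `F1Sign2/SymSquareAnatomyAtTwo.lean` (crux workfile `SymSquareAnatomyES34.lean` v2 9333133fa4de8611, VERBATIM)
# + REF1 g24's §319 probe block (`REF1-data/b319/Probe319.lean` 218d7a06bd7a7aaf, VERBATIM minus the `sorry` probe K319.0 and minus the K319.8 `def`, which lives in the statement file)

CONTENT (all PROVED, no `sorry`, no `def`): -es: `twoAdicDegreeUnit_le_congruenceUnit`, `localDegreeUnit_of_not_sq_dvd`, `one_le_torusUnitAt` (R319f: «keep the three kernel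
lemmas»); REF1 (namespace `…Kernel.REF1_319`): K319.1/K319.2 unit tables, K319.3a/b inertia order and residue law (Watkins Cor 2.2 ⇔ `p % e_p = 1`), `padicValNat_two_eq`,
K319.4 the λ-examples (erratum R319a: `p = 17`, `λ = 4` is type III), K319.5 `torusUnitAt_eq` / K319.5b, K319.6 (r-rows depend on `D` only via `D.f`), K319.7 the 6962e1
arithmetic (both v1 floors fail: `32 > 16`), K319.8 Manin glue `plain_iff_manin_of_eq` / `plain_ne_manin_of_shift`.  v1 → v2: the two bookkeeping glue theorems `motivicEulerFactorFloorR_of_v1` / `motivicEulerFactorCongruenceFloorR_of_v1` are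
WITHDRAWN IN PLACE — kept verbatim by the tree rule «append-only: deprecate, don't mutate» (a v2 that dropped them bounced `theorems.append-only` at preflight), now
themselves `@[deprecated]` because their hypotheses, the v1 pair, are `@[deprecated]` tombstones (REF1 §319 kills both in data; a deprecated declaration may name
deprecated constants without a linter warning, so nothing is switched off).  BSD is not proved by this; 23715 is not closed by this.
-/

open scoped Classical AddSubgroup
noncomputable section
set_option linter.dupNamespace false
set_option autoImplicit false

namespace Summit.BirchSwinnertonDyer.BirchSwinnertonDyer.Theorems.RankOneAtTwoSymSquareAnatomy.Kernel

open Literature.NumberTheory.EllipticCurves Literature.NumberTheory.EllipticCurves.ModularForms WeierstrassCurve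
open Summit.BirchSwinnertonDyer.BirchSwinnertonDyer.Theorems.RankOneAtTwoTwistLattice (primeCount primeStar)
open Summit.BirchSwinnertonDyer.BirchSwinnertonDyer.Theorems.RankOneAtTwoSymSquareAnatomy

/-- (-es g25 crux workfile `SymSquareAnatomyES34.lean` 9333133fa4de8611, VERBATIM.) The v1 law implies the repaired one (it only adds a hypothesis) — glue for provers / refuters.
(v2, typer -ty g22 after REF1 g24 §319: WITHDRAWN with its hypothesis — the v1 row is refuted in data and is now a `@[deprecated]` tombstone in the statement file; this theorem is KEPT VERBATIM by the tree rule «append-only: deprecate, don't mutate» (gate `theorems.append-only`), itself `@[deprecated]` (Lean does not warn on deprecated constants inside a deprecated declaration, so no linter is disabled).  Do not use.) -/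
@[deprecated "withdrawn bookkeeping: the hypothesis MotivicEulerFactorFloor (ES-34U v1) is refuted in data (6962e1; -es g25 addendum 2, REF1 §319 K319.7) and is a deprecated tombstone; use MotivicEulerFactorFloorR directly" (since := "2026-08-30")]
theorem motivicEulerFactorFloorR_of_v1 (h : MotivicEulerFactorFloor) : MotivicEulerFactorFloorR := by
  intro W _ _ _ D hopt hcm h2 hirr hmin _hns
  exact h W D hopt hcm h2 hirr hmin

/-- (-es g25 crux workfile `SymSquareAnatomyES34.lean` 9333133fa4de8611, VERBATIM.)
(v2, typer -ty g22 after REF1 g24 §319: WITHDRAWN with its hypothesis — the v1 row is refuted in data and is now a `@[deprecated]` tombstone in the statement file; this theorem is KEPT VERBATIM by the tree rule «append-only: deprecate, don't mutate» (gate `theorems.append-only`), itself `@[deprecated]` (Lean does not warn on deprecated constants inside a deprecated declaration, so no linter is disabled).  Do not use.) -/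
@[deprecated "withdrawn bookkeeping: the hypothesis MotivicEulerFactorCongruenceFloor (ES-34U♯ v1) is refuted in data (6962e1 via Agashe–Ribet–Stein Thm 2.1; REF1 §319 K319.7) and is a deprecated tombstone; use MotivicEulerFactorCongruenceFloorR directly" (since := "2026-08-30")]
theorem motivicEulerFactorCongruenceFloorR_of_v1 (h : MotivicEulerFactorCongruenceFloor) :
    MotivicEulerFactorCongruenceFloorR := by
  intro W _ _ _ D hcm h2 hirr hmin _hns
  exact h W D hcm h2 hirr hmin

/-- (-es g25 crux workfile `SymSquareAnatomyES34.lean` 9333133fa4de8611, VERBATIM.) -/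
theorem twoAdicDegreeUnit_le_congruenceUnit (v : ℕ) : twoAdicDegreeUnit v ≤ twoAdicCongruenceUnit v := by
  unfold twoAdicDegreeUnit twoAdicCongruenceUnit
  split_ifs <;> omega

/-- (-es g25 crux workfile `SymSquareAnatomyES34.lean` 9333133fa4de8611, VERBATIM.) One multiplicative unit per odd prime: with no additive odd prime the odd unit sum is the flat Atkin–Lehner count. -/
theorem localDegreeUnit_of_not_sq_dvd (W : WeierstrassCurve ℚ) {N p : ℕ} (h : ¬ p ^ 2 ∣ N) :
    localDegreeUnit W N p = 1 := by
  simp [localDegreeUnit, h]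

/-- (-es g25 crux workfile `SymSquareAnatomyES34.lean` 9333133fa4de8611, VERBATIM.) The torus unit is at least `1` for an odd prime `p` (both `p − 1` and `p + 1` are even). -/
theorem one_le_torusUnitAt (W : WeierstrassCurve ℚ) {p : ℕ} (hp : p.Prime) (hp2 : p ≠ 2) : 1 ≤ torusUnitAt W p := by
  have hodd : Odd p := hp.odd_of_ne_two hp2
  obtain ⟨k, hk⟩ := hodd
  unfold torusUnitAt
  have h2 : Nat.Prime 2 := Nat.prime_two
  haveI : Fact (Nat.Prime 2) := ⟨h2⟩
  split_ifs
  · have : 2 ∣ p - 1 := ⟨k, by omega⟩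
    have hne : p - 1 ≠ 0 := by have := hp.two_le; omega
    exact (padicValNat_dvd_iff_le hne).mp (by simpa using this)
  · have : 2 ∣ p + 1 := ⟨k + 1, by omega⟩
    exact (padicValNat_dvd_iff_le (by omega)).mp (by simpa using this)

/-! ## REF1 §319 probe block (`REF1-data/b319/Probe319.lean` 218d7a06bd7a7aaf, refuter-bsd-f1-sign2-ref1 g24; typer -ty g22 kernel v2: VERBATIM minus K319.0 (the
`sorry` elaboration probe) and minus the K319.8 `def OddTwistModularDegreeShiftManin` (a `def` — moved VERBATIM into the statement file; its two glue lemmas stay here);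
REF1 wrote it against the workfile text AS-IS (tree `Cruxes/RankOneAtTwoBigImageOddLocal/SymSquareAnatomyES34.lean`, sha16 9333133fa4de8611).
K319.0 elaboration of the seven Props · K319.1/2 unit tables · K319.3 inertia order / residue law (Watkins Cor 2.2 ⇔ `p % e = 1`)
· K319.4 the docstring's λ-examples · K319.5 torus unit unfolds to the pure residue function · K319.6 r-rows depend on `D` only via `D.f`
· K319.7 the `6962e1` arithmetic (U v1 AND U♯ v1 fail: `4·2^(1+2) = 32 > 16 = 2·2^3`, with `v₂ r = v₂ m = 3` by ARS Thm 2.1 since `2 ∥ N`)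
· K319.8 Manin-displayed form of ES-34V (Watkins §2.1 literally: `deg φ_E = deg φ_F · c_E²/c_F² · ∏ V_p`). -/
namespace REF1_319

open Summit.BirchSwinnertonDyer.BirchSwinnertonDyer.Theorems.RankOneAtTwoSymSquareAnatomy
open Literature.NumberTheory.EllipticCurves Literature.NumberTheory.EllipticCurves.ModularForms WeierstrassCurve
open Summit.BirchSwinnertonDyer.BirchSwinnertonDyer.Theorems.RankOneAtTwoTwistLattice (primeCount primeStar)

/-- K319.1: the 2-adic degree unit table `v = 0 … 8 ↦ 0,1,0,2,2,3,3,4,4` (docstring l.63). -/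
example : (List.range 9).map twoAdicDegreeUnit = [0, 1, 0, 2, 2, 3, 3, 4, 4] := by decide

/-- K319.2: the 2-adic congruence unit table `v = 0 … 8 ↦ 0,1,1,3,4,5,6,7,8` (docstring l.67). -/
example : (List.range 9).map twoAdicCongruenceUnit = [0, 1, 1, 3, 4, 5, 6, 7, 8] := by decide

/-- K319.3a: `e = 12 / gcd(12, v(Δ))` on the potentially-good additive valuations `2,3,4,6,8,9,10 ↦ 6,4,3,2,3,4,6`
(II, III, IV, I₀*, IV*, III*, II*), and the junk values `v = 0 ↦ 1`, `v = 1,5,7,11 ↦ 12`, `v = 12 ↦ 1`. -/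
example : [2, 3, 4, 6, 8, 9, 10].map (fun v => 12 / Nat.gcd 12 v) = [6, 4, 3, 2, 3, 4, 6] ∧
    [0, 1, 5, 7, 11, 12].map (fun v => 12 / Nat.gcd 12 v) = [1, 12, 12, 12, 12, 1] := by decide

/-- K319.3b: residue law — for odd `p`, `p % 6 = 1 ↔ p % 3 = 1 ↔ p ≡ 1, 7 (12)` (types II/IV, `e ∈ {6, 3}`) and
`p % 4 = 1 ↔ p ≡ 1, 5 (12)` (type III, `e = 4`; `p ≥ 5` prime, i.e. `2 ∤ p`, `3 ∤ p`): Watkins Cor 2.2 (`+` at 1 mod 12; `−` at 11 mod 12; at 5 mod 12 `+` iff III;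
at 7 mod 12 `−` iff III) is exactly `p % e = 1`. -/
example (p : ℕ) (hp : p % 2 = 1) (hp3 : p % 3 ≠ 0) :
    (p % 6 = 1 ↔ p % 3 = 1) ∧ (p % 3 = 1 ↔ (p % 12 = 1 ∨ p % 12 = 7)) ∧ (p % 4 = 1 ↔ (p % 12 = 1 ∨ p % 12 = 5)) ∧
    (p % 12 = 11 → p % 6 ≠ 1 ∧ p % 4 ≠ 1 ∧ p % 3 ≠ 1) ∧ (p % 12 = 1 → p % 6 = 1 ∧ p % 4 = 1 ∧ p % 3 = 1) := by
  omega

/-- helper: `v₂ n = k` from `2^k ∣ n ∧ ¬ 2^(k+1) ∣ n`. -/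
theorem padicValNat_two_eq {n k : ℕ} (hn : n ≠ 0) (h1 : 2 ^ k ∣ n) (h2 : ¬ 2 ^ (k + 1) ∣ n) :
    padicValNat 2 n = k := by
  haveI : Fact (Nat.Prime 2) := ⟨Nat.prime_two⟩
  have hk : k ≤ padicValNat 2 n := (padicValNat_dvd_iff_le hn).mp h1
  have hk' : ¬ (k + 1) ≤ padicValNat 2 n := fun h => h2 ((padicValNat_dvd_iff_le hn).mpr h)
  omega

/-- K319.4: the docstring's λ-examples.  `p = 17`: type III (`e = 4`, `17 % 4 = 1`, sign `+`) gives `λ = v₂(16) = 4`;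
types II/IV (`e = 6, 3`; `17 % 6 = 5`, `17 % 3 = 2`, sign `−`) give `λ = v₂(18) = 1` — so the docstring's
«`+4` at `p = 17` of Kodaira type II/IV» should read «type III» (R319a).  `p = 31`: III `−`, `λ = v₂(32) = 5`; II `+`, `λ = v₂(30) = 1`.
`p = 59`, IV* (`v = 8`, `e = 3`, `59 % 3 = 2`, sign `−`): `λ = v₂(60) = 2` ✓ (the `6962e1` witness). -/
example : (17 % 4 = 1 ∧ 17 % 6 ≠ 1 ∧ 17 % 3 ≠ 1) ∧ (31 % 4 ≠ 1 ∧ 31 % 6 = 1) ∧ (12 / Nat.gcd 12 8 = 3 ∧ 59 % 3 ≠ 1) := by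
  decide
example : padicValNat 2 16 = 4 ∧ padicValNat 2 18 = 1 ∧ padicValNat 2 32 = 5 ∧ padicValNat 2 30 = 1 ∧
    padicValNat 2 60 = 2 :=
  ⟨padicValNat_two_eq (by norm_num) (by norm_num) (by norm_num),
   padicValNat_two_eq (by norm_num) (by norm_num) (by norm_num),
   padicValNat_two_eq (by norm_num) (by norm_num) (by norm_num),
   padicValNat_two_eq (by norm_num) (by norm_num) (by norm_num),
   padicValNat_two_eq (by norm_num) (by norm_num) (by norm_num)⟩

/-- K319.5: the torus unit unfolds to the pure residue function of `(p, e_p)` — no other datum of `W` enters. -/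
theorem torusUnitAt_eq (W : WeierstrassCurve ℚ) (p : ℕ) :
    torusUnitAt W p = if p % inertiaOrderAt W p = 1 then padicValNat 2 (p - 1) else padicValNat 2 (p + 1) := by
  unfold torusUnitAt symSquareSignAt
  split_ifs <;> simp_all

/-- K319.5b: at a multiplicative odd prime the unit is `1`; at `p = 3` with `v₃(N) = 2` it is `2`, with `v₃(N) ≥ 3` it is `1`. -/
example (W : WeierstrassCurve ℚ) : localDegreeUnit W (2 * 3 * 5) 5 = 1 ∧ localDegreeUnit W (4 * 9 * 7) 3 = 2 ∧
    localDegreeUnit W (27 * 11) 3 = 1 := by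
  refine ⟨?_, ?_, ?_⟩ <;> simp [localDegreeUnit]

/-- K319.6: the r-currency rows depend on the parametrisation datum `D` only through `D.f` (so the missing optimality
hypothesis in U♯-R / ES-34W is harmless): two data with the same newform give the same conclusion. -/
example (W : WeierstrassCurve ℚ) [W.IsElliptic] [W.IsGloballyMinimal] [NeZero (W.conductorNorm ℤ)]
    (D D₂ : ModularParametrizationData W (W.conductorNorm ℤ)) (h : D.f = D₂.f) :
    (Nat.card (W.selmerGroup 2) *
        2 ^ (twoAdicCongruenceUnit (padicValNat 2 (W.conductorNorm ℤ)) + oddUnitSum W (W.conductorNorm ℤ))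
      ≤ 2 * 2 ^ padicValNat 2 (congruenceNumber D.f)) ↔
    (Nat.card (W.selmerGroup 2) *
        2 ^ (twoAdicCongruenceUnit (padicValNat 2 (W.conductorNorm ℤ)) + oddUnitSum W (W.conductorNorm ℤ))
      ≤ 2 * 2 ^ padicValNat 2 (congruenceNumber D₂.f)) := by
  rw [h]

/-- K319.7: the `6962e1` arithmetic (`N = 2·59²`, `dim Sel₂ = 2`, `u₂(1) = u₂ʳ(1) = 1`, `λ₅₉ = 2`, `v₂ m = 3`, and
`v₂ r = v₂ m = 3` by Agashe–Ribet–Stein Thm 2.1 since `ord₂ N = 1`): BOTH v1 floors fail, `2² · 2^(1+2) = 32 > 16 = 2 · 2³`. -/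
example : twoAdicDegreeUnit 1 = 1 ∧ twoAdicCongruenceUnit 1 = 1 ∧ ¬ (2 ^ 2 * 2 ^ (1 + 2) ≤ 2 * 2 ^ 3) := by decide

/-! K319.8 (REF1): the Manin-displayed print-literal form `OddTwistModularDegreeShiftManin` is declared in the statement file
`F1Sign2/SymSquareAnatomyAtTwo.lean` (v2, right after `OddTwistModularDegreeShift`); REF1's two glue lemmas follow VERBATIM. -/

/-- … and the PLAIN row is the Manin form plus `v₂ c = v₂ c'` (kernel glue, both directions). -/
theorem plain_iff_manin_of_eq (m m' s : ℕ) (c c' : ℤ) (hc : padicValInt 2 c = padicValInt 2 c') :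
    (padicValNat 2 m' = padicValNat 2 m + s) ↔
    (padicValNat 2 m' + 2 * padicValInt 2 c = padicValNat 2 m + 2 * padicValInt 2 c' + s) := by
  rw [hc]; omega

/-- … while with `v₂ c' = v₂ c + 1` (a Manin constant `2` on the twist side) the two rows CONTRADICT each other. -/
theorem plain_ne_manin_of_shift (m m' s : ℕ) (c c' : ℤ) (hc : padicValInt 2 c' = padicValInt 2 c + 1)
    (hM : padicValNat 2 m' + 2 * padicValInt 2 c = padicValNat 2 m + 2 * padicValInt 2 c' + s) :
    padicValNat 2 m' ≠ padicValNat 2 m + s := by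
  omega

end REF1_319

end Summit.BirchSwinnertonDyer.BirchSwinnertonDyer.Theorems.RankOneAtTwoSymSquareAnatomy.Kernel
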